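import Summits.HodgeConjecture.CorCM.GaloisTwentyFourDegenerateModels
import HarnessLib

/-!
# LIFTING BALANCED CERTIFICATES FROM A SUBGROUP: `BAD(H, c) ⟹ BAD(G, c)` for `H ≤ G = Gal(K/ℚ)` carrying a normal
# subgroup `N` of `G` over which the certificate is balanced

COR-CM (cell `pub-hodgecm2`), binder seat b04 (gen 39), count-neutral own lane «Galois-CM-type classification».  KERNEL ONLY:
theorems; no definition, no named fact, no `sorry`.  `HC_CM` is neither used nor claimed.

So far BAD-ness (a PRIMITIVE DEGENERATE CM type) was transported UP along CM quotients (`CorCM/GaloisDegenerateMonotonicity*`,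
gens 31–32: `BAD(K^N) ⟹ BAD(K)`).  This file transports it up along SUBGROUPS: a balanced-set certificate (gen 20's format,
`exists_simple_degenerate_of_model_balanced`: a CM set `T₁` with trivial left stabiliser and a finite `D₁` with
`2·#{x ∈ D₁ : x g ∈ T₁} = #D₁` for all `g`, `c D₁ ≠ D₁`) on a subgroup `ι : H₀ ↪ Gal(K/ℚ)` containing complex conjugation
`c = ι(c₁)` LIFTS to `Gal(K/ℚ)` as soon as

* `ι(H₀)` contains a normal subgroup `N ≠ 1` of `Gal(K/ℚ)` with `c ∉ N`, and
* the certificate is BALANCED OVER `N`: the multiset of `N`-cosets of `D₁` equals that of `c₁ D₁` (stated through any map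
  `π₁ : H₀ → X` separating the `N`-cosets: `D₁.map π₁ = (c₁ D₁).map π₁` as multisets).

For the two-sheet groups `Q_{2ⁿ} × C_p`, `C_p ⋊ C_{2ⁿ}` (`N = C_p`) the second condition holds for EVERY balanced set (the odd
block at the trivial character of `C_p` is never singular, so an annihilator has zero sums along `C_p`-cosets), and it is
checked by `decide` on the tree's certificates.  THE LIFT: `T = ι(T₁) ∪ (S₀ ∖ ι(H₀))` with `S₀` any right-`N`-invariant CM set of
`Gal(K/ℚ)` (pulled back from `Gal/N`), `D = ι(D₁)`; for `g ∈ ι(H₀)` the count is the old one, for `g ∉ ι(H₀)` the translate `D g`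
lies outside `ι(H₀)` where `T` is `N`-invariant and the balance over `N` gives exactly half; the left stabiliser of `T` is trivial
because a stabilising `v ∉ ι(H₀)` would make `T₁` invariant under `N ∩ …`, i.e. under a non-trivial element of `H₀`.

* §1 `exists_finset_mem_iff_not_mem` (orbit representatives of a free involution), `exists_cm_finset_mul_mem_iff`
  (right-`N`-invariant CM sets), `countP_eq_of_map_eq` (counting through `π₁`).
* §2 **`exists_balanced_certificate_of_subgroup`** — the abstract lift (finite groups only).
* §3 **`exists_simple_degenerate_of_subgroup_certificate`** — Galois dress, MODEL-FREE (`G₀ = Gal(K/ℚ)` itself): a simple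
  DEGENERATE CM abelian variety of dimension `[K:ℚ]/2` with an exceptional Hodge class on some power.

Consumers (gen 39): `CorCM/GaloisQuaternionCyclicLift` (`Q₈ × C_p ↪ Gal`, `p = 3, 5, 11`; `Q₁₆ × C₇ ↪ Gal`) and
`CorCM/GaloisOddPrimeShapesQuaternionBad` (the shapes Q× and QK of gen 38 are BAD for `p ∈ {3, 5, 7, 11}`).

## References

* [Shimura1998] G. Shimura, *Abelian Varieties with Complex Multiplication and Modular Functions*, §6.2 Thm. 3, §8.2 Prop. 26.
* [Gordon1999HodgeAVSurvey] B. B. Gordon, *A survey of the Hodge conjecture for abelian varieties*, Thm. 6.4, §9.3.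
* [Dodson1984] B. Dodson, *The structure of Galois groups of CM-fields*, Trans. AMS 283 (1984), §3.1.1, §5.3.
-/

noncomputable section

open CategoryTheory CategoryTheory.Limits NumberField
open scoped BigOperators

namespace Summit.HodgeConjecture.CorCM.GaloisModels

open Literature.NumberTheory.ComplexMultiplication
open Literature.AlgebraicGeometry.Motives (AbelianVariety CMType)
open Literature.AlgebraicGeometry.HodgeTheory
open Literature.AlgebraicGeometry.ComplexMultiplication (IsCMTypeRealisation)
open Literature.AlgebraicGeometry.Pohlmann1968
open Literature.Barriers.HodgeConjecture (divisorClassesSpan)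
open Summit.HodgeConjecture.CorCM.GaloisRank

/-! ## §1 CM sets with prescribed invariance; counting through a coset map -/

section Abstract

variable {G₀ H₀ : Type*} [Group G₀] [Group H₀]

/-- A fixed-point-free involution of a finite type admits a set meeting every orbit exactly once. [folklore] -/
theorem exists_finset_mem_iff_not_mem {X : Type*} [Fintype X] [DecidableEq X] (τ : X → X)
    (hτ : ∀ x, τ (τ x) = x) (hfree : ∀ x, τ x ≠ x) : ∃ S : Finset X, ∀ x, x ∈ S ↔ τ x ∉ S := by
  classical
  let e := Fintype.equivFin X
  refine ⟨Finset.univ.filter fun x => e x < e (τ x), fun x => ?_⟩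
  simp only [Finset.mem_filter, Finset.mem_univ, true_and, hτ, not_lt]
  have hne : e x ≠ e (τ x) := fun h => hfree x (e.injective h).symm
  exact ⟨le_of_lt, fun h => lt_of_le_of_ne h hne⟩

/-- **Right-`N`-invariant CM sets exist**: for a normal subgroup `N` and an element `c₀ ∉ N` with `c₀² = 1` there is
`S₀ ⊆ G₀` with `x ∈ S₀ ↔ c₀ x ∉ S₀` and `x n ∈ S₀ ↔ x ∈ S₀` (`n ∈ N`) — pulled back from orbit representatives of
`q ↦ c̄₀ q` on `G₀/N`. [folklore] -/
theorem exists_cm_finset_mul_mem_iff [Finite G₀] [DecidableEq G₀] (N : Subgroup G₀) [hN : N.Normal] (c₀ : G₀)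
    (hc2 : c₀ * c₀ = 1) (hcN : c₀ ∉ N) :
    ∃ S₀ : Finset G₀, (∀ x, x ∈ S₀ ↔ c₀ * x ∉ S₀) ∧ ∀ x : G₀, ∀ n ∈ N, x * n ∈ S₀ ↔ x ∈ S₀ := by
  classical
  haveI : Fintype (G₀ ⧸ N) := Fintype.ofFinite _
  haveI : Fintype G₀ := Fintype.ofFinite _
  have hfree : ∀ q : G₀ ⧸ N, (c₀ : G₀ ⧸ N) * q ≠ q := by
    intro q h
    obtain ⟨x, rfl⟩ := QuotientGroup.mk_surjective q
    rw [← QuotientGroup.mk_mul, QuotientGroup.eq] at h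
    have h2 := hN.conj_mem _ h x
    rw [show x * ((c₀ * x)⁻¹ * x) * x⁻¹ = c₀⁻¹ by group] at h2
    exact hcN ((Subgroup.inv_mem_iff N).mp h2)
  obtain ⟨S, hS⟩ := exists_finset_mem_iff_not_mem (X := G₀ ⧸ N) (fun q => (c₀ : G₀ ⧸ N) * q)
    (fun q => by rw [← mul_assoc, ← QuotientGroup.mk_mul, hc2, QuotientGroup.mk_one, one_mul]) hfree
  refine ⟨Finset.univ.filter fun x => (x : G₀ ⧸ N) ∈ S, fun x => ?_, fun x n hn => ?_⟩
  · simp only [Finset.mem_filter, Finset.mem_univ, true_and, QuotientGroup.mk_mul]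
    exact hS _
  · simp only [Finset.mem_filter, Finset.mem_univ, true_and]
    have : ((x * n : G₀) : G₀ ⧸ N) = (x : G₀ ⧸ N) := by
      rw [QuotientGroup.mk_mul, (QuotientGroup.eq_one_iff n).mpr hn, mul_one]
    rw [this]

/-- Counting through a map `π₁`: if `P` is constant on the fibres of `π₁` and two multisets have the same image under
`π₁`, they contain the same number of elements satisfying `P`. [folklore] -/
theorem countP_eq_of_map_eq {α X : Type*} (π₁ : α → X) (P : α → Prop) [DecidablePred P]
    (hP : ∀ x y, π₁ x = π₁ y → (P x ↔ P y)) {s t : Multiset α} (h : s.map π₁ = t.map π₁) :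
    s.countP P = t.countP P := by
  classical
  let Pbar : X → Prop := fun X₀ => ∃ x, π₁ x = X₀ ∧ P x
  have hPbar : ∀ x, Pbar (π₁ x) ↔ P x :=
    fun x => ⟨fun ⟨y, hy, hPy⟩ => (hP y x hy).mp hPy, fun hx => ⟨x, rfl, hx⟩⟩
  have key : ∀ u : Multiset α, u.countP P = (u.map π₁).countP Pbar := fun u => by
    rw [Multiset.countP_map, Multiset.countP_eq_card_filter]
    congr 1
    exact Multiset.filter_congr fun x _ => (hPbar x).symm
  rw [key, key, h]

/-- `(s.filter p).card` as a multiset count. [folklore] -/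
theorem card_filter_eq_countP {α : Type*} (s : Finset α) (p : α → Prop) [DecidablePred p] :
    (s.filter p).card = s.val.countP p := by
  rw [Finset.card_def, Finset.filter_val, Multiset.countP_eq_card_filter]

/-! ## §2 The abstract lift -/

/-- **LIFTING A BALANCED CERTIFICATE FROM A SUBGROUP (abstract).**  `ι : H₀ ↪ G₀`, `c₁ ∈ H₀` with `c₁² = 1`; `N` a normal
subgroup of `G₀` inside `ι(H₀)` with `ι(c₁) ∉ N`, `N ≠ 1`; `π₁ : H₀ → X` a map separating the `ι⁻¹(N)`-cosets
(`π₁ x = π₁ y ⟹ ι(x⁻¹y) ∈ N`).  A CM set `T₁ ⊆ H₀` for `c₁` with trivial left stabiliser and a finite `D₁ ⊆ H₀` balanced for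
`T₁` (`2·#{x ∈ D₁ : x g ∈ T₁} = #D₁` for all `g ∈ H₀`), moved by `c₁`, and BALANCED OVER `N` (`D₁.map π₁ = (c₁D₁).map π₁` as
multisets) LIFT to a CM set `T ⊆ G₀` for `ι(c₁)` with trivial left stabiliser and a balanced finite `D ⊆ G₀` moved by `ι(c₁)`:
`T = ι(T₁) ∪ (S₀ ∖ ι(H₀))` for a right-`N`-invariant CM set `S₀`, `D = ι(D₁)`. [folklore] -/
theorem exists_balanced_certificate_of_subgroup [Finite G₀] [DecidableEq G₀] [DecidableEq H₀]
    (ι : H₀ →* G₀) (hι : Function.Injective ι) (c₁ : H₀) (hc2 : c₁ * c₁ = 1)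
    (N : Subgroup G₀) [hN : N.Normal] (hNι : ∀ n ∈ N, n ∈ Set.range ι) (hcN : ι c₁ ∉ N) (hN1 : N ≠ ⊥)
    {X : Type*} (π₁ : H₀ → X) (hπ : ∀ x y : H₀, π₁ x = π₁ y → ι (x⁻¹ * y) ∈ N)
    (T₁ : Finset H₀) (hcm₁ : ∀ x, x ∈ T₁ ↔ c₁ * x ∉ T₁)
    (hprim₁ : ∀ v : H₀, v ≠ 1 → ∃ w, ¬ (w ∈ T₁ ↔ v * w ∈ T₁))
    (D₁ : Finset H₀) (hbal₁ : ∀ g : H₀, 2 * (D₁.filter fun x => x * g ∈ T₁).card = D₁.card)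
    (hmov₁ : ∃ x ∈ D₁, c₁ * x ∉ D₁)
    (hsym₁ : D₁.val.map π₁ = (D₁.val.map fun x => c₁ * x).map π₁) :
    ∃ T D : Finset G₀, (∀ x, x ∈ T ↔ ι c₁ * x ∉ T) ∧ (∀ v : G₀, v ≠ 1 → ∃ w, ¬ (w ∈ T ↔ v * w ∈ T)) ∧
      (∀ g : G₀, 2 * (D.filter fun x => x * g ∈ T).card = D.card) ∧ ∃ x ∈ D, ι c₁ * x ∉ D := by
  classical
  haveI : Fintype G₀ := Fintype.ofFinite _
  obtain ⟨S₀, hS₀cm, hS₀N⟩ :=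
    exists_cm_finset_mul_mem_iff N (ι c₁) (by rw [← map_mul, hc2, map_one]) hcN
  let emb : H₀ ↪ G₀ := ⟨ι, hι⟩
  let T : Finset G₀ := T₁.map emb ∪ S₀.filter fun y => y ∉ Set.range ι
  let D : Finset G₀ := D₁.map emb
  -- membership in `T` on and off the subgroup
  have hTι : ∀ h : H₀, ι h ∈ T ↔ h ∈ T₁ := fun h => by
    constructor
    · intro hh
      rcases Finset.mem_union.mp hh with hh | hh
      · obtain ⟨h', hh', heq⟩ := Finset.mem_map.mp hh
        exact hι heq ▸ hh'
      · exact absurd (Set.mem_range_self h) (Finset.mem_filter.mp hh).2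
    · intro hh
      exact Finset.mem_union.mpr (Or.inl (Finset.mem_map_of_mem emb hh))
  have hTout : ∀ y : G₀, y ∉ Set.range ι → (y ∈ T ↔ y ∈ S₀) := fun y hy => by
    constructor
    · intro hh
      rcases Finset.mem_union.mp hh with hh | hh
      · obtain ⟨h', -, heq⟩ := Finset.mem_map.mp hh
        exact absurd ⟨h', heq⟩ hy
      · exact (Finset.mem_filter.mp hh).1
    · intro hh
      exact Finset.mem_union.mpr (Or.inr (Finset.mem_filter.mpr ⟨hh, hy⟩))
  -- products with an element off the subgroup stay off the subgroup
  have hout_left : ∀ v : G₀, v ∉ Set.range ι → ∀ z : H₀, v * ι z ∉ Set.range ι := fun v hv z ⟨y, hy⟩ =>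
    hv ⟨y * z⁻¹, by rw [map_mul, hy, map_inv, mul_inv_cancel_right]⟩
  have hout_right : ∀ g : G₀, g ∉ Set.range ι → ∀ z : H₀, ι z * g ∉ Set.range ι := fun g hg z ⟨y, hy⟩ =>
    hg ⟨z⁻¹ * y, by rw [map_mul, hy, map_inv, inv_mul_cancel_left]⟩
  have hS₀c : ∀ y : G₀, ι c₁ * y ∈ S₀ ↔ y ∉ S₀ := fun y => by
    have h := hS₀cm (ι c₁ * y)
    rwa [← mul_assoc, ← map_mul, hc2, map_one, one_mul] at h
  refine ⟨T, D, ?_, ?_, ?_, ?_⟩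
  · -- `T` is a CM set for `ι c₁`
    intro y
    by_cases hy : y ∈ Set.range ι
    · obtain ⟨h, rfl⟩ := hy
      rw [← map_mul, hTι, hTι]
      exact hcm₁ h
    · have hcy : ι c₁ * y ∉ Set.range ι := fun ⟨h, hh⟩ =>
        hy ⟨c₁⁻¹ * h, by rw [map_mul, hh, map_inv, inv_mul_cancel_left]⟩
      rw [hTout y hy, hTout _ hcy]
      exact hS₀cm y
  · -- trivial left stabiliser
    intro v hv
    by_cases hvr : v ∈ Set.range ι
    · obtain ⟨v₁, rfl⟩ := hvr
      have hv₁ : v₁ ≠ 1 := by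
        rintro rfl
        exact hv (map_one ι)
      obtain ⟨w₁, hw₁⟩ := hprim₁ v₁ hv₁
      exact ⟨ι w₁, by rwa [← map_mul, hTι, hTι]⟩
    · by_contra hall
      push Not at hall
      obtain ⟨n, hnN, hn1⟩ : ∃ n ∈ N, n ≠ 1 := by
        by_contra h
        push Not at h
        exact hN1 ((Subgroup.eq_bot_iff_forall N).mpr h)
      obtain ⟨n₁, rfl⟩ := hNι n hnN
      have hn₁ : n₁ ≠ 1 := by
        rintro rfl
        exact hn1 (map_one ι)
      obtain ⟨w₁, hw₁⟩ := hprim₁ n₁ hn₁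
      apply hw₁
      -- `T₁` is invariant under right multiplication by `ι⁻¹(N)`
      have key : ∀ h m : H₀, ι m ∈ N → (h * m ∈ T₁ ↔ h ∈ T₁) := fun h m hm => by
        have h1 := hall (ι h)
        have h2 := hall (ι (h * m))
        rw [hTι] at h1 h2
        rw [h1, h2, hTout _ (hout_left v hvr _), hTout _ (hout_left v hvr _), map_mul, ← mul_assoc]
        exact hS₀N _ _ hm
      have hconj : ι (w₁⁻¹ * n₁ * w₁) ∈ N := by
        rw [map_mul, map_mul, map_inv]
        have := hN.conj_mem _ hnN (ι w₁)⁻¹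
        rwa [inv_inv] at this
      rw [show n₁ * w₁ = w₁ * (w₁⁻¹ * n₁ * w₁) by group]
      exact (key w₁ _ hconj).symm
  · -- balanced
    intro g
    have hD : (D.filter fun x => x * g ∈ T).card = (D₁.filter fun x => ι x * g ∈ T).card := by
      rw [Finset.filter_map, Finset.card_map]
      rfl
    rw [hD, Finset.card_map]
    by_cases hg : g ∈ Set.range ι
    · obtain ⟨g₁, rfl⟩ := hg
      have : (D₁.filter fun x => ι x * ι g₁ ∈ T) = D₁.filter fun x => x * g₁ ∈ T₁ :=
        Finset.filter_congr fun x _ => by rw [← map_mul, hTι]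
      rw [this]
      exact hbal₁ g₁
    · -- off the subgroup: `T` is `N`-invariant there and `D₁` is balanced over `N`
      have hPT : ∀ x : H₀, (ι x * g ∈ T ↔ ι x * g ∈ S₀) := fun x => hTout _ (hout_right g hg x)
      have hPc : ∀ x : H₀, (ι (c₁ * x) * g ∈ S₀ ↔ ¬ ι x * g ∈ S₀) := fun x => by
        rw [map_mul, mul_assoc]
        exact hS₀c _
      have hPπ : ∀ x y : H₀, π₁ x = π₁ y → (ι x * g ∈ S₀ ↔ ι y * g ∈ S₀) := fun x y hxy => by
        have hm := hπ x y hxy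
        have hn' : g⁻¹ * ι (x⁻¹ * y) * g ∈ N := by
          have := hN.conj_mem _ hm g⁻¹
          rwa [inv_inv] at this
        have heq : ι y * g = ι x * g * (g⁻¹ * ι (x⁻¹ * y) * g) := by
          rw [map_mul, map_inv]
          group
        rw [heq]
        exact (hS₀N _ _ hn').symm
      have hcount : (D₁.filter fun x => ι x * g ∈ S₀).card = (D₁.filter fun x => ι (c₁ * x) * g ∈ S₀).card := by
        rw [card_filter_eq_countP, card_filter_eq_countP]
        have h2 : D₁.val.countP (fun x => ι (c₁ * x) * g ∈ S₀) =
            (D₁.val.map fun x => c₁ * x).countP fun x => ι x * g ∈ S₀ := by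
          rw [Multiset.countP_map, ← Multiset.countP_eq_card_filter]
        rw [h2]
        exact countP_eq_of_map_eq π₁ _ hPπ hsym₁
      have hneg : (D₁.filter fun x => ι (c₁ * x) * g ∈ S₀) = D₁.filter fun x => ¬ ι x * g ∈ S₀ :=
        Finset.filter_congr fun x _ => hPc x
      have hsplit := Finset.card_filter_add_card_filter_not
        (s := D₁) (fun x => ι x * g ∈ S₀)
      have hgoal : (D₁.filter fun x => ι x * g ∈ T) = D₁.filter fun x => ι x * g ∈ S₀ :=
        Finset.filter_congr fun x _ => hPT x
      rw [hgoal]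
      rw [hneg] at hcount
      omega
  · -- moved by `ι c₁`
    obtain ⟨x₁, hx₁, hcx₁⟩ := hmov₁
    refine ⟨ι x₁, Finset.mem_map_of_mem emb hx₁, fun h => hcx₁ ?_⟩
    rw [← map_mul] at h
    exact (Finset.mem_map' emb).mp h

end Abstract

/-! ## §3 Galois dress (model-free) -/

variable {K : Type} [Field K] [NumberField K] [IsCMField K]

/-- **A BALANCED CERTIFICATE ON A SUBGROUP OF `Gal(K/ℚ)`, BALANCED OVER A NORMAL SUBGROUP `N`, MAKES `K` BAD.**
`ι : H₀ ↪ Gal(K/ℚ)` with `ι(c₁) =` complex conjugation; `N ◁ Gal(K/ℚ)`, `1 ≠ N ⊆ ι(H₀)`, `c ∉ N`; `π₁ : H₀ → X` separating the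
`ι⁻¹(N)`-cosets; a CM set `T₁ ⊆ H₀` for `c₁` with trivial left stabiliser and a finite `D₁` balanced for `T₁`, moved by `c₁` and
balanced over `N`.  Then `K` carries a PRIMITIVE DEGENERATE CM type, realised by a SIMPLE abelian variety of dimension `[K:ℚ]/2`
with a rational `(p,p)` class outside the divisor ring on some power. [cite: Shimura1998, §6.2 Thm. 3 and §8.2 Prop. 26]
[cite: Gordon1999HodgeAVSurvey, Thm. 6.4 and §9.3] -/
theorem exists_simple_degenerate_of_subgroup_certificate [IsGalois ℚ K] {H₀ : Type*} [Group H₀] [Fintype H₀]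
    [DecidableEq H₀] (ι : H₀ →* (K ≃ₐ[ℚ] K)) (hι : Function.Injective ι) (c₁ : H₀)
    (hc : ι c₁ = (IsCMField.complexConj K).restrictScalars ℚ)
    (N : Subgroup (K ≃ₐ[ℚ] K)) [N.Normal] (hNι : ∀ n ∈ N, n ∈ Set.range ι)
    (hcN : (IsCMField.complexConj K).restrictScalars ℚ ∉ N) (hN1 : N ≠ ⊥)
    {X : Type*} (π₁ : H₀ → X) (hπ : ∀ x y : H₀, π₁ x = π₁ y → ι (x⁻¹ * y) ∈ N)
    (T₁ : Finset H₀) (hcm₁ : ∀ x, x ∈ T₁ ↔ c₁ * x ∉ T₁)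
    (hprim₁ : ∀ v : H₀, v ≠ 1 → ∃ w, ¬ (w ∈ T₁ ↔ v * w ∈ T₁))
    (D₁ : Finset H₀) (hbal₁ : ∀ g : H₀, 2 * (D₁.filter fun x => x * g ∈ T₁).card = D₁.card)
    (hmov₁ : ∃ x ∈ D₁, c₁ * x ∉ D₁)
    (hsym₁ : D₁.val.map π₁ = (D₁.val.map fun x => c₁ * x).map π₁) :
    ∃ (Φ : CMType K) (φ₀ : K →+* ℂ) (A : AbelianVariety ℂ) (ι' : 𝓞 K →+* End A)
      (θ : K →+* Module.End ℂ (complexBetti A.X 1)),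
      IsPrimitive (ℂ ≃+* ℂ) Φ.1 φ₀ ∧ ¬ IsNondegenerate Φ ∧ IsCMTypeRealisation Φ A ι' θ ∧ A.IsSimple ∧
      A.dim = Module.finrank ℚ K / 2 ∧
      ∃ n p : ℕ, ∃ x : complexBetti (⨁ fun _ : Fin n => A).X (2 * p), IsRationalClass x ∧
        IsOfHodgeType (⨁ fun _ : Fin n => A).dim (⨁ fun _ : Fin n => A).X (2 * p) p p x ∧
        x ∉ divisorClassesSpan (⨁ fun _ : Fin n => A).X (⨁ fun _ : Fin n => A).dim p := by
  classical
  haveI : Fintype (K ≃ₐ[ℚ] K) := Fintype.ofFinite _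
  have hc2 : c₁ * c₁ = 1 := hι (by rw [map_mul, hc, GaloisOctic.complexConj_mul_self, map_one])
  obtain ⟨T, D, hcm, hprim, hbal, hmov⟩ := exists_balanced_certificate_of_subgroup ι hι c₁ hc2 N hNι
    (by rw [hc]; exact hcN) hN1 π₁ hπ T₁ hcm₁ hprim₁ D₁ hbal₁ hmov₁ hsym₁
  rw [hc] at hcm hmov
  have h := exists_simple_degenerate_of_model_balanced (MulEquiv.refl (K ≃ₐ[ℚ] K)) _ rfl T hcm hprim D hbal hmov
  rwa [card_model_eq_finrank (MulEquiv.refl (K ≃ₐ[ℚ] K))] at h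

end Summit.HodgeConjecture.CorCM.GaloisModels

end
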